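import Literature.Topology.FourManifolds.IwaseToriFibre
import Literature.Topology.FourManifolds.IwaseHandleEmbedding
import Literature.Topology.FourManifolds.LickorishTwistProfile
import Literature.Topology.FourManifolds.MTorusCoordinates
import Mathlib.Geometry.Manifold.LocalDiffeomorph
import Mathlib.Analysis.SpecialFunctions.Trigonometric.InverseDeriv
import HarnessLib

/-!
# The graph zone of the Iwase tori

Part of the construction of the tubular neighbourhood maps `T₀, T₁ : T² × ℝ² → S² × ℝ²` of the
model datum in the proof of Iwase's Proposition 3.5 [cite: Iwase1988, Prop. 3.5, p. 296]
(reduction `TorusSurgeryIwaseReduction.iwase1988_of_model`).  Over the *graph zone* (the part of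
the singular torus `Σ₀` which is the graph `w = g(x)` over the sphere minus the polar caps) the
first torus is `TV (z, t, ν) = (cylPt z ξ, toE W)` with `(ξ, W) = fibV (t, ν)` the fibre family of
`IwaseToriFibre`.

* cylindrical coordinates `cylPt z ξ = (√(1 - ξ²) z, ξ)` on `S²` with inverse `cylInv`, as a
  partial diffeomorphism `cylPD : S¹ × (-1, 1) ≅ S² ∖ {poles}`; `chartV`, `assocV`;
* the zone map `TV`, `isLocalDiffeomorphAt_TV` (composition of partial diffeomorphisms — no
  derivative is computed);
* tube estimates (`zoneV t : t² < 491/500`, `‖ν‖ ≤ ν_max`): `ξ ∈ (-1, 1)`, `X ≥ 0.0169`,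
  `‖W - g(X)‖ ≤ 10⁻³`, `‖W‖ < 197/200` (tube ⊆ polar region), `muP_XV_WV` (the slice cut-off of
  the polar model vanishes on the tube), `pol_XV_WV_eq : pol = (nrm ν)⁻¹ (nrm E(ν))⁻¹`;
* values (`TV_zero`, `TV_circleMul`, `TV_neg`, `TV_polar_iff`) and **exactness**
  `polarMap_TV_shear : polarMap (TV (unit(v)·z, t, ν(v))) = TV1 (z, t, ν(v))` (`v ≠ 0`), where
  `TV1 (z, t, ν) = TV (rotV ν · z, t, ν)` with the *smooth* correction `rotV ν = circleOf (nrm E(ν))⁻¹`.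

All statements are elementary [folklore].

## References
* Z. Iwase, *Dehn-surgery along a torus T²-knot*, Pacific J. Math. 133 (1988), 289–299,
  Prop. 3.5. [cite: Iwase1988]
-/

open scoped ContDiff Topology Manifold
open Set Function Real Filter Metric

noncomputable section

namespace Literature.Topology.FourManifolds

namespace IwaseTori


/-! ### Cylindrical coordinates on the sphere -/

/-- **The meridian point of height `ξ`**: `(√(1 - ξ²), 0, ξ)` (for `ξ ∈ [-1, 1]`), as the Fermi
point `Y(arccos ξ, 0)`. [folklore] -/
def merid (ξ : ℝ) : sphere (0 : EuclideanSpace ℝ (Fin 3)) 1 := IwaseHandle.fermi (arccos ξ) 0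

/-- Coordinates of the meridian point. [folklore] -/
theorem coe_merid {ξ : ℝ} (hξ : ξ ∈ Icc (-1 : ℝ) 1) :
    (merid ξ : EuclideanSpace ℝ (Fin 3)) = WithLp.toLp 2 ![Real.sqrt (1 - ξ ^ 2), 0, ξ] := by
  rw [merid, IwaseHandle.coe_fermi]
  ext i
  fin_cases i <;> simp [Real.sin_arccos, Real.cos_arccos hξ.1 hξ.2]

/-- The meridian point map is smooth on `(-1, 1)`. [folklore] -/
theorem contMDiffAt_merid {ξ : ℝ} (hξ : ξ ∈ Ioo (-1 : ℝ) 1) : ContMDiffAt 𝓘(ℝ, ℝ) (𝓡 2) ∞ merid ξ := by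
  have h : ContDiffAt ℝ ∞ (fun ξ : ℝ => (arccos ξ, (0 : ℝ))) ξ :=
    (contDiffAt_arccos (by linarith [hξ.1]) (by linarith [hξ.2])).prodMk contDiffAt_const
  have h2 := IwaseHandle.contMDiff_fermi.contMDiffAt.comp ξ h.contMDiffAt
  exact h2

/-- **Cylindrical coordinates**: the point of `S²` with direction `z ∈ S¹` and height `ξ`,
`(√(1 - ξ²) z, ξ)`. [folklore] -/
def cylPt (z : sphere (0 : EuclideanSpace ℝ (Fin 2)) 1) (ξ : ℝ) : sphere (0 : EuclideanSpace ℝ (Fin 3)) 1 :=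
  rotateSphereTwo z (merid ξ)

/-- Coordinates of `cylPt`. [folklore] -/
theorem coe_cylPt (z : sphere (0 : EuclideanSpace ℝ (Fin 2)) 1) {ξ : ℝ} (hξ : ξ ∈ Icc (-1 : ℝ) 1) :
    (cylPt z ξ : EuclideanSpace ℝ (Fin 3)) = WithLp.toLp 2
      ![(z : EuclideanSpace ℝ (Fin 2)) 0 * Real.sqrt (1 - ξ ^ 2),
        (z : EuclideanSpace ℝ (Fin 2)) 1 * Real.sqrt (1 - ξ ^ 2), ξ] := by
  rw [cylPt]
  ext i
  fin_cases i <;> simp [coe_merid hξ]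

/-- The height of `cylPt z ξ` is `ξ`. [folklore] -/
theorem cylPt_apply_two (z : sphere (0 : EuclideanSpace ℝ (Fin 2)) 1) {ξ : ℝ} (hξ : ξ ∈ Icc (-1 : ℝ) 1) :
    (cylPt z ξ : EuclideanSpace ℝ (Fin 3)) 2 = ξ := by
  rw [coe_cylPt z hξ]; simp

/-- The equatorial coordinate of `cylPt z ξ` is `√(1 - ξ²) · toC z`. [folklore] -/
theorem ycoord_cylPt (z : sphere (0 : EuclideanSpace ℝ (Fin 2)) 1) {ξ : ℝ} (hξ : ξ ∈ Icc (-1 : ℝ) 1) :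
    IwasePolar.ycoord (cylPt z ξ) = ↑(Real.sqrt (1 - ξ ^ 2)) * toC (z : EuclideanSpace ℝ (Fin 2)) := by
  rw [IwasePolar.ycoord, coe_cylPt z hξ]
  apply Complex.ext <;> simp [toC] <;> ring

/-- `x(cylPt z ξ) = 1 - ξ²`. [folklore] -/
theorem xsq_cylPt (z : sphere (0 : EuclideanSpace ℝ (Fin 2)) 1) {ξ : ℝ} (hξ : ξ ∈ Icc (-1 : ℝ) 1) :
    IwasePolar.xsq (cylPt z ξ) = 1 - ξ ^ 2 := by
  have h1 : 0 ≤ 1 - ξ ^ 2 := by nlinarith [hξ.1, hξ.2]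
  rw [IwasePolar.xsq, ycoord_cylPt z hξ, norm_mul, Complex.norm_real, norm_toC_sphere, mul_one,
    Real.norm_of_nonneg (Real.sqrt_nonneg _), Real.sq_sqrt h1]

/-- `toC` of a circle product is the complex product. [folklore] -/
theorem toC_circleMul (v u : sphere (0 : EuclideanSpace ℝ (Fin 2)) 1) :
    toC (circleMul v u : EuclideanSpace ℝ (Fin 2)) =
      toC (v : EuclideanSpace ℝ (Fin 2)) * toC (u : EuclideanSpace ℝ (Fin 2)) := by
  apply Complex.ext
  · simp [toC]
  · simp [toC]; ring

/-- Composition of rotations about the polar axis is rotation by the circle product. [folklore] -/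
theorem rotateSphereTwo_rotateSphereTwo (w z : sphere (0 : EuclideanSpace ℝ (Fin 2)) 1)
    (p : sphere (0 : EuclideanSpace ℝ (Fin 3)) 1) :
    rotateSphereTwo w (rotateSphereTwo z p) = rotateSphereTwo (circleMul w z) p := by
  apply Subtype.ext; ext i
  fin_cases i <;> simp <;> ring

/-- **Rotating a cylindrical point rotates its direction.** [folklore] -/
theorem rotateSphereTwo_cylPt (w z : sphere (0 : EuclideanSpace ℝ (Fin 2)) 1) (ξ : ℝ) :
    rotateSphereTwo w (cylPt z ξ) = cylPt (circleMul w z) ξ := by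
  rw [cylPt, cylPt, rotateSphereTwo_rotateSphereTwo]

/-- **The mirror of a cylindrical point negates the height.** [folklore] -/
theorem mirrorS2_cylPt (z : sphere (0 : EuclideanSpace ℝ (Fin 2)) 1) {ξ : ℝ} (hξ : ξ ∈ Icc (-1 : ℝ) 1) :
    IwaseHandle.mirrorS2 (cylPt z ξ) = cylPt z (-ξ) := by
  have hξ' : -ξ ∈ Icc (-1 : ℝ) 1 := ⟨by linarith [hξ.2], by linarith [hξ.1]⟩
  apply Subtype.ext
  rw [coe_cylPt z hξ']
  ext i
  fin_cases i <;> simp [coe_cylPt z hξ]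

/-- `cylPt` is jointly smooth on heights in `(-1, 1)`. [folklore] -/
theorem contMDiffAt_cylPt {p : sphere (0 : EuclideanSpace ℝ (Fin 2)) 1 × ℝ} (hp : p.2 ∈ Ioo (-1 : ℝ) 1) :
    ContMDiffAt ((𝓡 1).prod 𝓘(ℝ, ℝ)) (𝓡 2) ∞ (fun p : sphere (0 : EuclideanSpace ℝ (Fin 2)) 1 × ℝ =>
      cylPt p.1 p.2) p :=
  contMDiff_rotateSphereTwo.contMDiffAt.comp p
    (contMDiffAt_fst.prodMk ((contMDiffAt_merid hp).comp p contMDiffAt_snd))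

/-! ### The inverse: direction and height -/

/-- The equatorial vector `y(P) = (x₀, x₁) ∈ ℝ²` of a point of the sphere. [folklore] -/
def yE (P : sphere (0 : EuclideanSpace ℝ (Fin 3)) 1) : EuclideanSpace ℝ (Fin 2) :=
  WithLp.toLp 2 ![(P : EuclideanSpace ℝ (Fin 3)) 0, (P : EuclideanSpace ℝ (Fin 3)) 1]

/-- Coordinates of `yE`. [folklore] -/
@[simp] theorem yE_apply_zero (P : sphere (0 : EuclideanSpace ℝ (Fin 3)) 1) :
    yE P 0 = (P : EuclideanSpace ℝ (Fin 3)) 0 := rfl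

/-- Coordinates of `yE`. [folklore] -/
@[simp] theorem yE_apply_one (P : sphere (0 : EuclideanSpace ℝ (Fin 3)) 1) :
    yE P 1 = (P : EuclideanSpace ℝ (Fin 3)) 1 := rfl

/-- `‖y(P)‖² = 1 - x₂²`. [folklore] -/
theorem norm_yE_sq (P : sphere (0 : EuclideanSpace ℝ (Fin 3)) 1) :
    ‖yE P‖ ^ 2 = 1 - (P : EuclideanSpace ℝ (Fin 3)) 2 ^ 2 := by
  rw [EuclideanSpace.norm_eq, Real.sq_sqrt (Finset.sum_nonneg fun _ _ => sq_nonneg _), Fin.sum_univ_two]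
  simp only [yE_apply_zero, yE_apply_one, Real.norm_eq_abs, sq_abs]
  linear_combination IwaseHandle.sphere_coord_sq_sum P

/-- `‖y(P)‖ = √(1 - x₂²)`. [folklore] -/
theorem norm_yE (P : sphere (0 : EuclideanSpace ℝ (Fin 3)) 1) :
    ‖yE P‖ = Real.sqrt (1 - (P : EuclideanSpace ℝ (Fin 3)) 2 ^ 2) := by
  rw [← norm_yE_sq, Real.sqrt_sq (norm_nonneg _)]

/-- `y(P) ≠ 0` off the poles (`|x₂| < 1`). [folklore] -/
theorem yE_ne_zero {P : sphere (0 : EuclideanSpace ℝ (Fin 3)) 1} (hP : |(P : EuclideanSpace ℝ (Fin 3)) 2| < 1) :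
    yE P ≠ 0 := by
  rw [← norm_ne_zero_iff, norm_yE]
  apply Real.sqrt_ne_zero'.2
  have := abs_lt.1 hP
  nlinarith

/-- `yE` is smooth on the sphere. [folklore] -/
theorem contMDiff_yE : ContMDiff (𝓡 2) 𝓘(ℝ, EuclideanSpace ℝ (Fin 2)) ∞ yE := by
  have h : ContDiff ℝ ∞ fun v : EuclideanSpace ℝ (Fin 3) => (WithLp.toLp 2 ![v 0, v 1] : EuclideanSpace ℝ (Fin 2)) := by
    apply PiLp.contDiff_toLp.comp
    rw [contDiff_pi]
    intro i
    fin_cases i <;> simp <;> fun_prop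
  haveI := Fact.mk (@finrank_euclideanSpace_fin ℝ _ 3)
  exact h.comp_contMDiff contMDiff_coe_sphere

/-- `y(cylPt z ξ) = √(1 - ξ²) • z`. [folklore] -/
theorem yE_cylPt (z : sphere (0 : EuclideanSpace ℝ (Fin 2)) 1) {ξ : ℝ} (hξ : ξ ∈ Icc (-1 : ℝ) 1) :
    yE (cylPt z ξ) = Real.sqrt (1 - ξ ^ 2) • (z : EuclideanSpace ℝ (Fin 2)) := by
  ext i
  fin_cases i <;> simp [yE, coe_cylPt z hξ, mul_comm]

/-- **The inverse of the cylindrical coordinates**: direction `y/‖y‖` and height `x₂`. [folklore] -/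
def cylInv (P : sphere (0 : EuclideanSpace ℝ (Fin 3)) 1) : sphere (0 : EuclideanSpace ℝ (Fin 2)) 1 × ℝ :=
  (unitVector₀ (yE P), (P : EuclideanSpace ℝ (Fin 3)) 2)

/-- `cylInv (cylPt z ξ) = (z, ξ)` for `|ξ| < 1`. [folklore] -/
theorem cylInv_cylPt (z : sphere (0 : EuclideanSpace ℝ (Fin 2)) 1) {ξ : ℝ} (hξ : ξ ∈ Ioo (-1 : ℝ) 1) :
    cylInv (cylPt z ξ) = (z, ξ) := by
  have hξ' : ξ ∈ Icc (-1 : ℝ) 1 := ⟨hξ.1.le, hξ.2.le⟩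
  have hpos : 0 < Real.sqrt (1 - ξ ^ 2) := Real.sqrt_pos.2 (by nlinarith [hξ.1, hξ.2])
  rw [cylInv, yE_cylPt z hξ', unitVector₀_smul_coe hpos, cylPt_apply_two z hξ']

/-- `cylPt (cylInv P) = P` off the poles. [folklore] -/
theorem cylPt_cylInv {P : sphere (0 : EuclideanSpace ℝ (Fin 3)) 1} (hP : |(P : EuclideanSpace ℝ (Fin 3)) 2| < 1) :
    cylPt (cylInv P).1 (cylInv P).2 = P := by
  obtain ⟨h1, h2⟩ := abs_lt.1 hP
  have hmem : (P : EuclideanSpace ℝ (Fin 3)) 2 ∈ Icc (-1 : ℝ) 1 := ⟨h1.le, h2.le⟩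
  have hy : yE P ≠ 0 := yE_ne_zero hP
  have hn : ‖yE P‖ ≠ 0 := norm_ne_zero_iff.2 hy
  have hunit : (unitVector₀ (yE P) : EuclideanSpace ℝ (Fin 2)) = ‖yE P‖⁻¹ • yE P := by
    rw [unitVector₀_of_ne_zero hy, coe_unitVector]
  apply Subtype.ext
  simp only [cylInv]
  rw [coe_cylPt _ hmem, ← norm_yE]
  ext i
  fin_cases i
  · simp [hunit]; field_simp
  · simp [hunit]; field_simp
  · simp

/-- `cylInv` is smooth off the poles. [folklore] -/
theorem contMDiffAt_cylInv {P : sphere (0 : EuclideanSpace ℝ (Fin 3)) 1} (hP : |(P : EuclideanSpace ℝ (Fin 3)) 2| < 1) :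
    ContMDiffAt (𝓡 2) ((𝓡 1).prod 𝓘(ℝ, ℝ)) ∞ cylInv P := by
  have h1 : ContMDiffAt (𝓡 2) (𝓡 1) ∞ (fun P => unitVector₀ (yE P)) P :=
    (contMDiffOn_unitVector₀.contMDiffAt (isOpen_ne.mem_nhds (yE_ne_zero hP))).comp P
      contMDiff_yE.contMDiffAt
  exact h1.prodMk (IwaseHandle.contMDiff_sphere_coord 2).contMDiffAt

/-- **Cylindrical coordinates as a partial diffeomorphism `S¹ × (-1, 1) ≅ S² ∖ {poles}`.**
[folklore] -/
def cylPD : PartialDiffeomorph ((𝓡 1).prod 𝓘(ℝ, ℝ)) (𝓡 2)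
    (sphere (0 : EuclideanSpace ℝ (Fin 2)) 1 × ℝ) (sphere (0 : EuclideanSpace ℝ (Fin 3)) 1) ∞ where
  toFun p := cylPt p.1 p.2
  invFun := cylInv
  source := univ ×ˢ Ioo (-1 : ℝ) 1
  target := {P | |(P : EuclideanSpace ℝ (Fin 3)) 2| < 1}
  map_source' := by
    rintro ⟨z, ξ⟩ ⟨-, hξ⟩
    change |(cylPt z ξ : EuclideanSpace ℝ (Fin 3)) 2| < 1
    rw [cylPt_apply_two z ⟨hξ.1.le, hξ.2.le⟩]
    exact abs_lt.2 hξ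
  map_target' := by
    intro P hP
    exact ⟨mem_univ _, abs_lt.1 hP⟩
  left_inv' := by
    rintro ⟨z, ξ⟩ ⟨-, hξ⟩
    exact cylInv_cylPt z hξ
  right_inv' := by
    intro P hP
    exact cylPt_cylInv hP
  open_source := isOpen_univ.prod isOpen_Ioo
  open_target := isOpen_lt (continuous_abs.comp (IwaseHandle.contMDiff_sphere_coord 2).continuous)
    continuous_const
  contMDiffOn_toFun := by
    rintro ⟨z, ξ⟩ ⟨-, hξ⟩
    exact (contMDiffAt_cylPt (p := (z, ξ)) hξ).contMDiffWithinAt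
  contMDiffOn_invFun := fun P hP => (contMDiffAt_cylInv hP).contMDiffWithinAt

/-- The plane `ℂ ≅ ℝ²` as a diffeomorphism (`toE`). [folklore] -/
def toEDiffeo : ℂ ≃ₘ⟮𝓘(ℝ, ℂ), 𝓘(ℝ, EuclideanSpace ℝ (Fin 2))⟯ EuclideanSpace ℝ (Fin 2) :=
  Complex.orthonormalBasisOneI.repr.toContinuousLinearEquiv.toDiffeomorph

/-- `toEDiffeo` is `toE`. [folklore] -/
@[simp] theorem toEDiffeo_apply (W : ℂ) : toEDiffeo W = IwasePolar.toE W := rfl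

/-- **The graph-zone chart** `((z, ξ), W) ↦ (cylPt z ξ, toE W)` as a partial diffeomorphism.
[folklore] -/
def chartV : PartialDiffeomorph (((𝓡 1).prod 𝓘(ℝ, ℝ)).prod 𝓘(ℝ, ℂ))
    ((𝓡 2).prod 𝓘(ℝ, EuclideanSpace ℝ (Fin 2)))
    ((sphere (0 : EuclideanSpace ℝ (Fin 2)) 1 × ℝ) × ℂ)
    (sphere (0 : EuclideanSpace ℝ (Fin 3)) 1 × EuclideanSpace ℝ (Fin 2)) ∞ :=
  PartialDiffeomorph.prod' cylPD toEDiffeo.toPartialDiffeomorph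

/-- The reassociation `S¹ × (ℝ × ℂ) ≅ (S¹ × ℝ) × ℂ` as a diffeomorphism (Mathlib's
`Diffeomorph.prodAssoc` wants the two right factors modelled on the same vector space). [folklore] -/
def assocV : (sphere (0 : EuclideanSpace ℝ (Fin 2)) 1 × (ℝ × ℂ)) ≃ₘ⟮(𝓡 1).prod 𝓘(ℝ, ℝ × ℂ),
    ((𝓡 1).prod 𝓘(ℝ, ℝ)).prod 𝓘(ℝ, ℂ)⟯ ((sphere (0 : EuclideanSpace ℝ (Fin 2)) 1 × ℝ) × ℂ) where
  toFun p := ((p.1, p.2.1), p.2.2)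
  invFun q := (q.1.1, (q.1.2, q.2))
  left_inv _ := rfl
  right_inv _ := rfl
  contMDiff_toFun := by
    have h2 : ContMDiff ((𝓡 1).prod 𝓘(ℝ, ℝ × ℂ)) 𝓘(ℝ, ℝ × ℂ) ∞
        fun p : sphere (0 : EuclideanSpace ℝ (Fin 2)) 1 × (ℝ × ℂ) => p.2 := contMDiff_snd
    have h21 : ContMDiff ((𝓡 1).prod 𝓘(ℝ, ℝ × ℂ)) 𝓘(ℝ, ℝ) ∞
        fun p : sphere (0 : EuclideanSpace ℝ (Fin 2)) 1 × (ℝ × ℂ) => p.2.1 :=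
      (contDiff_fst.contMDiff).comp h2
    have h22 : ContMDiff ((𝓡 1).prod 𝓘(ℝ, ℝ × ℂ)) 𝓘(ℝ, ℂ) ∞
        fun p : sphere (0 : EuclideanSpace ℝ (Fin 2)) 1 × (ℝ × ℂ) => p.2.2 :=
      (contDiff_snd.contMDiff).comp h2
    exact (contMDiff_fst.prodMk h21).prodMk h22
  contMDiff_invFun := by
    have h1 : ContMDiff (((𝓡 1).prod 𝓘(ℝ, ℝ)).prod 𝓘(ℝ, ℂ)) ((𝓡 1).prod 𝓘(ℝ, ℝ)) ∞
        fun q : (sphere (0 : EuclideanSpace ℝ (Fin 2)) 1 × ℝ) × ℂ => q.1 := contMDiff_fst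
    have h11 : ContMDiff (((𝓡 1).prod 𝓘(ℝ, ℝ)).prod 𝓘(ℝ, ℂ)) (𝓡 1) ∞
        fun q : (sphere (0 : EuclideanSpace ℝ (Fin 2)) 1 × ℝ) × ℂ => q.1.1 := contMDiff_fst.comp h1
    have h12 : ContMDiff (((𝓡 1).prod 𝓘(ℝ, ℝ)).prod 𝓘(ℝ, ℂ)) 𝓘(ℝ, ℝ) ∞
        fun q : (sphere (0 : EuclideanSpace ℝ (Fin 2)) 1 × ℝ) × ℂ => q.1.2 := contMDiff_snd.comp h1
    have h2 : ContMDiff (((𝓡 1).prod 𝓘(ℝ, ℝ)).prod 𝓘(ℝ, ℂ)) 𝓘(ℝ, ℂ) ∞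
        fun q : (sphere (0 : EuclideanSpace ℝ (Fin 2)) 1 × ℝ) × ℂ => q.2 := contMDiff_snd
    exact h11.prodMk (h12.prodMk_space h2)

/-! ### The graph-zone map -/

/-- **The graph-zone map** `TV (z, t, ν) = (cylPt z ξ, toE W)` with `(ξ, W) = fibV (t, ν)`: the
fibre point with core height `t`, direction `z` and fibre coordinate `ν`. [folklore] -/
def TV (p : sphere (0 : EuclideanSpace ℝ (Fin 2)) 1 × ℝ × ℂ) :
    sphere (0 : EuclideanSpace ℝ (Fin 3)) 1 × EuclideanSpace ℝ (Fin 2) :=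
  (cylPt p.1 (xiV p.2.1 p.2.2), IwasePolar.toE (WV p.2.1 p.2.2))

/-- `TV` factors through the chart, the reassociation and `id × fibV`. [folklore] -/
theorem TV_eq (p : sphere (0 : EuclideanSpace ℝ (Fin 2)) 1 × ℝ × ℂ) :
    TV p = chartV (assocV (Prod.map id fibV p)) := rfl

/-- **`TV` is a local diffeomorphism** at points with `|ξ| < 1` and `‖ν‖ < ν_max`. [folklore] -/
theorem isLocalDiffeomorphAt_TV {p : sphere (0 : EuclideanSpace ℝ (Fin 2)) 1 × ℝ × ℂ}
    (hξ : xiV p.2.1 p.2.2 ∈ Ioo (-1 : ℝ) 1) (hν : ‖p.2.2‖ < nuMax) :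
    IsLocalDiffeomorphAt ((𝓡 1).prod 𝓘(ℝ, ℝ × ℂ)) ((𝓡 2).prod 𝓘(ℝ, EuclideanSpace ℝ (Fin 2))) ∞ TV p := by
  have h1 : IsLocalDiffeomorphAt ((𝓡 1).prod 𝓘(ℝ, ℝ × ℂ)) ((𝓡 1).prod 𝓘(ℝ, ℝ × ℂ)) ∞
      (Prod.map id fibV) p := by
    rw [← Prod.mk.eta (p := p)]
    refine IsLocalDiffeomorphAt.prodMap' ?_ (isLocalDiffeomorphAt_fibV hν)
    exact (Diffeomorph.refl (𝓡 1) (sphere (0 : EuclideanSpace ℝ (Fin 2)) 1) ∞).isLocalDiffeomorph p.1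
  have h2 := assocV.isLocalDiffeomorph (Prod.map id fibV p)
  have hmem : assocV (Prod.map id fibV p) ∈ chartV.source := by
    change ((p.1, (fibV p.2).1), (fibV p.2).2) ∈ (univ ×ˢ Ioo (-1 : ℝ) 1) ×ˢ (univ : Set ℂ)
    exact ⟨⟨mem_univ _, hξ⟩, mem_univ _⟩
  have h3 := chartV.isLocalDiffeomorphAt _ _ _ hmem
  have h12 := IsLocalDiffeomorphAt.comp (hf := h1) (hg := h2)
  have h123 := IsLocalDiffeomorphAt.comp (hf := h12) (hg := h3)
  exact h123

/-! ### Estimates on the graph-zone tube -/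

/-- The graph-zone bound on the loop coordinate: `t² < 491/500 (= 0.982)`. We name the zone
condition. [folklore] -/
def zoneV (t : ℝ) : Prop := t ^ 2 < 491 / 500

/-- `|q(ν)| ≤ 1/1000` for `‖ν‖ ≤ ν_max`. [folklore] -/
theorem abs_qOf_le_thousandth {ν : ℂ} (hν : ‖ν‖ ≤ nuMax) : |qOf ν| ≤ 1 / 1000 := by
  have h1 := abs_qOf_le_of_le hν; have h2 := qMax_le; linarith

/-- `‖e^ν - 1‖ ≤ 2 ν_max ≤ 1/1000` for `‖ν‖ ≤ ν_max`. [folklore] -/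
theorem norm_exp_sub_one_le_thousandth {ν : ℂ} (hν : ‖ν‖ ≤ nuMax) : ‖Complex.exp ν - 1‖ ≤ 1 / 1000 := by
  have h2 := nuMax_le
  have := Complex.norm_exp_sub_one_le (x := ν) (by linarith)
  linarith

/-- `0 ≤ ε(X) ≤ 1` for `X ≥ 0`. [folklore] -/
theorem epsF_le_one {X : ℝ} (hX : 0 ≤ X) : epsF X ≤ 1 := by
  rcases le_or_gt X (1 / 10) with h | h
  · rw [epsF_of_le h]; linarith
  rcases le_or_gt (3 / 20) X with h' | h'
  · rw [epsF_of_ge h']; norm_num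
  · have h0 := cut_nonneg (1 / 10) (3 / 20) X
    have h1 := cut_le_one (1 / 10) (3 / 20) X
    unfold epsF; nlinarith

/-- `nrm` of a positive real multiple. [folklore] -/
theorem nrm_ofReal_mul {r : ℝ} (hr : 0 < r) (z : ℂ) :
    UnknotSurgery.nrm (↑r * z) = UnknotSurgery.nrm z := by
  rw [UnknotSurgery.nrm_mul, UnknotSurgery.nrm_ofReal_of_pos hr, one_mul]

section TubeEstimates

variable {t : ℝ} {ν : ℂ} (ht : zoneV t) (hν : ‖ν‖ ≤ nuMax)
include ht hν

/-- **The ambient height stays in `(-1, 1)`**: `ξ² ≤ 0.9831`. [folklore] -/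
theorem xiV_sq_le : xiV t ν ^ 2 ≤ 9831 / 10000 := by
  have hq : |qOf ν| ≤ 1 / 1000 := abs_qOf_le_thousandth hν
  obtain ⟨hq1, hq2⟩ := abs_le.1 hq
  obtain ⟨hμ0, hμ1⟩ := muF_mem (1 - t ^ 2)
  have hS : SF t (qOf ν) ≤ 1 + 1 / 1000 := by unfold SF; nlinarith
  have hS0 : 0 ≤ SF t (qOf ν) := (SF_pos (η := t) (by linarith)).le
  rw [xiV, XiF, mul_pow, Real.sq_sqrt hS0]
  unfold zoneV at ht
  nlinarith [sq_nonneg t]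

/-- `ξ ∈ (-1, 1)`. [folklore] -/
theorem xiV_mem_Ioo : xiV t ν ∈ Ioo (-1 : ℝ) 1 := by
  have h := xiV_sq_le ht hν
  have := abs_lt_of_sq_lt_sq (show xiV t ν ^ 2 < 1 ^ 2 by linarith) zero_le_one
  exact ⟨(abs_lt.1 this).1, (abs_lt.1 this).2⟩

/-- `ξ ∈ [-1, 1]`. [folklore] -/
theorem xiV_mem_Icc : xiV t ν ∈ Icc (-1 : ℝ) 1 :=
  ⟨(xiV_mem_Ioo ht hν).1.le, (xiV_mem_Ioo ht hν).2.le⟩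

/-- **The ambient polar distance is at least `0.0169`.** [folklore] -/
theorem XV_ge : 169 / 10000 ≤ XV t ν := by
  have := xiV_sq_le ht hν; rw [XV]; linarith

omit ht in
/-- `X ≤ 1.001`. [folklore] -/
theorem XV_le : XV t ν ≤ 1001 / 1000 := by
  have hq : |qOf ν| ≤ 1 / 1000 := abs_qOf_le_thousandth hν
  have h := one_sub_XiF_sq (η := t) (q := qOf ν) (by linarith [abs_nonneg (qOf ν)])
  obtain ⟨hμ0, hμ1⟩ := muF_mem (1 - t ^ 2)
  obtain ⟨hq1, hq2⟩ := abs_le.1 hq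
  rw [XV, xiV, h]
  nlinarith [sq_nonneg t]

/-- `X ≥ 0`. [folklore] -/
theorem XV_nonneg : 0 ≤ XV t ν := by linarith [XV_ge ht hν]

/-- **The plane coordinate of a tube point is within `1/1000` of the torus height**:
`‖W - g(X)‖ ≤ 1/1000`. [folklore] -/
theorem norm_WV_sub_le : ‖WV t ν - ↑(IwasePolar.gprof (XV t ν))‖ ≤ 1 / 1000 := by
  rw [WV, add_sub_cancel_left, norm_mul, Complex.norm_real, Real.norm_of_nonneg (epsF_pos _).le]
  have h1 := epsF_le_one (XV_nonneg ht hν)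
  have h2 := norm_exp_sub_one_le_thousandth hν
  nlinarith [norm_nonneg (Complex.exp ν - 1), (epsF_pos (XV t ν)).le]

/-- `‖W‖ ≤ g(X) + 1/1000`. [folklore] -/
theorem norm_WV_le : ‖WV t ν‖ ≤ IwasePolar.gprof (XV t ν) + 1 / 1000 := by
  have h := norm_WV_sub_le ht hν
  have := norm_sub_norm_le (WV t ν) (↑(IwasePolar.gprof (XV t ν)) : ℂ)
  rw [Complex.norm_real, Real.norm_of_nonneg (IwasePolar.gprof_nonneg _)] at this
  linarith

omit ht in
/-- `g(X) ≤ 1 - X` on the tube (also for `X > 1`, where `g = 0`). [folklore] -/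
theorem gprof_XV_le : IwasePolar.gprof (XV t ν) ≤ 1 - XV t ν + 1 / 1000 := by
  rcases le_or_gt (XV t ν) 1 with h | h
  · have := IwasePolar.gprof_le h; linarith
  · rw [IwasePolar.gprof_of_ge (by linarith)]; have := XV_le (t := t) hν; linarith

/-- **Tube points are in the polar region**: `‖W‖ < 197/200`. [folklore] -/
theorem norm_WV_lt : ‖WV t ν‖ < 197 / 200 := by
  have h1 := norm_WV_le ht hν
  have h3 := XV_ge ht hν
  rcases le_or_gt (XV t ν) 1 with h | h
  · have := IwasePolar.gprof_le h; linarith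
  · rw [IwasePolar.gprof_of_ge (by linarith)] at h1; linarith

/-- `‖W‖ < 1`. [folklore] -/
theorem norm_WV_lt_one : ‖WV t ν‖ < 1 := by linarith [norm_WV_lt ht hν]

/-- **The polar slice cut-off vanishes on the graph-zone tube.** Either `‖W‖ ≤ 9/10`, or else
`g(X) > 0.89`, `Re W ≥ 0` (so `|arg W| ≤ π/2`) and `X/(1 - ‖W‖) ≤ 1.07`, so the argument of the
cut-off is negative. [folklore] -/
theorem muP_XV_WV : IwasePolar.muP (XV t ν) (WV t ν) = 0 := by
  rcases le_or_gt ‖WV t ν‖ (9 / 10) with h | h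
  · exact IwasePolar.muP_eq_zero_of_norm_le h
  · apply IwasePolar.muP_eq_zero_of_inner_le
    have hW1 := norm_WV_lt_one ht hν
    have hg : 89 / 100 < IwasePolar.gprof (XV t ν) := by linarith [norm_WV_le ht hν]
    -- `Re W ≥ 0`
    have hre : 0 ≤ (WV t ν).re := by
      have hsub := norm_WV_sub_le ht hν
      have := Complex.abs_re_le_norm (WV t ν - ↑(IwasePolar.gprof (XV t ν)))
      rw [Complex.sub_re, Complex.ofReal_re] at this
      have := (abs_le.1 (this.trans hsub)).1
      linarith
    have harg : |Complex.arg (WV t ν)| ≤ π / 2 := Complex.abs_arg_le_pi_div_two_iff.2 hre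
    have harg2 : (Complex.arg (WV t ν)) ^ 2 ≤ (π / 2) ^ 2 := by
      rw [← sq_abs]; exact pow_le_pow_left₀ (abs_nonneg _) harg 2
    have hπ : π < 3.15 := pi_lt_d2
    have hπ2 : (π / 2) ^ 2 ≤ 1.575 ^ 2 := pow_le_pow_left₀ (by positivity) (by linarith) 2
    -- `X ≤ 1` (else `g = 0`), so `‖W‖ ≤ 1 - X + 1/1000` and `X / (1 - ‖W‖) ≤ 1.07`
    have hX := XV_ge ht hν
    have hX1 : XV t ν ≤ 1 := by
      by_contra hcon
      push Not at hcon
      rw [IwasePolar.gprof_of_ge (by linarith)] at hg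
      norm_num at hg
    have h1W : XV t ν - 1 / 1000 ≤ 1 - ‖WV t ν‖ := by
      linarith [norm_WV_le ht hν, IwasePolar.gprof_le hX1]
    have hpos : 0 < 1 - ‖WV t ν‖ := by linarith
    have hdiv : XV t ν / (1 - ‖WV t ν‖) ≤ 107 / 100 := by
      rw [div_le_iff₀ hpos]; linarith
    rw [IwasePolar.inner]
    linarith

/-- **The polar phase on the graph-zone tube is the inverse unit vector of `W - g(X)`.**
[folklore] -/
theorem pol_XV_WV : IwasePolar.pol (XV t ν) (WV t ν) =
    (UnknotSurgery.nrm (WV t ν - ↑(IwasePolar.gprof (XV t ν))))⁻¹ := by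
  rcases lt_or_ge ‖WV t ν‖ (9 / 10) with h | h
  · rw [IwasePolar.pol_eq_lowPol h, IwasePolar.lowPol]
  · have hW0 : WV t ν ≠ 0 := by
      intro h0; rw [h0, norm_zero] at h; norm_num at h
    exact IwasePolar.pol_eq_of_muP_eq_zero hW0 (muP_XV_WV ht hν)

/-- **The polar phase on the tube factors through the fibre coordinate**:
`pol = (nrm ν)⁻¹ (nrm E(ν))⁻¹`. [folklore] -/
theorem pol_XV_WV_eq :
    IwasePolar.pol (XV t ν) (WV t ν) = (UnknotSurgery.nrm ν)⁻¹ * (UnknotSurgery.nrm (Efun ν))⁻¹ := by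
  rw [pol_XV_WV ht hν, WV_sub_gprof, mul_left_comm, nrm_ofReal_mul (epsF_pos _),
    UnknotSurgery.nrm_mul, mul_inv]

end TubeEstimates

/-! ### Values of the graph-zone map -/

/-- The height of a tube point. [folklore] -/
theorem TV_fst_apply_two {z : sphere (0 : EuclideanSpace ℝ (Fin 2)) 1} {t : ℝ} {ν : ℂ} (ht : zoneV t)
    (hν : ‖ν‖ ≤ nuMax) : ((TV (z, t, ν)).1 : EuclideanSpace ℝ (Fin 3)) 2 = xiV t ν :=
  cylPt_apply_two z (xiV_mem_Icc ht hν)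

/-- `x` of a tube point is `X`. [folklore] -/
theorem xsq_TV_fst {z : sphere (0 : EuclideanSpace ℝ (Fin 2)) 1} {t : ℝ} {ν : ℂ} (ht : zoneV t)
    (hν : ‖ν‖ ≤ nuMax) : IwasePolar.xsq (TV (z, t, ν)).1 = XV t ν := by
  rw [TV, xsq_cylPt z (xiV_mem_Icc ht hν), XV]

/-- The plane coordinate of a tube point is `W`. [folklore] -/
@[simp] theorem toC_TV_snd (p : sphere (0 : EuclideanSpace ℝ (Fin 2)) 1 × ℝ × ℂ) :
    toC (TV p).2 = WV p.2.1 p.2.2 := by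
  rw [TV, IwasePolar.toC_toE]

/-- The norm of the plane coordinate of a tube point. [folklore] -/
theorem norm_TV_snd (p : sphere (0 : EuclideanSpace ℝ (Fin 2)) 1 × ℝ × ℂ) :
    ‖(TV p).2‖ = ‖WV p.2.1 p.2.2‖ := by
  rw [← norm_toC, toC_TV_snd]

/-- **Tube points lie in the polar region** `‖w‖ < 197/200`. [folklore] -/
theorem norm_TV_snd_lt {z : sphere (0 : EuclideanSpace ℝ (Fin 2)) 1} {t : ℝ} {ν : ℂ} (ht : zoneV t)
    (hν : ‖ν‖ ≤ nuMax) : ‖(TV (z, t, ν)).2‖ < 197 / 200 := by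
  rw [norm_TV_snd]; exact norm_WV_lt ht hν

/-- **A tube point is on the polar torus iff its fibre coordinate vanishes.** [folklore] -/
theorem TV_polar_iff {z : sphere (0 : EuclideanSpace ℝ (Fin 2)) 1} {t : ℝ} {ν : ℂ} (ht : zoneV t)
    (hν : ‖ν‖ ≤ nuMax) :
    toC (TV (z, t, ν)).2 = ↑(IwasePolar.gprof (IwasePolar.xsq (TV (z, t, ν)).1)) ↔ ν = 0 := by
  rw [toC_TV_snd, xsq_TV_fst ht hν]
  change WV t ν = _ ↔ _
  rw [← sub_eq_zero, WV_sub_gprof, mul_eq_zero, mul_eq_zero]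
  have hε : (↑(epsF (XV t ν)) : ℂ) ≠ 0 := Complex.ofReal_ne_zero.2 (epsF_pos _).ne'
  have hE : Efun ν ≠ 0 := Efun_ne_zero (by linarith [nuMax_le])
  simp [hε, hE]

/-- **The core of the graph zone**: `TV (z, t, 0) = (cylPt z t, toE (g(1 - t²)))`. [folklore] -/
theorem TV_zero (z : sphere (0 : EuclideanSpace ℝ (Fin 2)) 1) (t : ℝ) :
    TV (z, t, 0) = (cylPt z t, IwasePolar.toE ↑(IwasePolar.gprof (1 - t ^ 2))) := by
  simp [TV, xiV, XV, WV]

/-- **Rotating the direction rotates the tube point.** [folklore] -/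
theorem TV_circleMul (w z : sphere (0 : EuclideanSpace ℝ (Fin 2)) 1) (t : ℝ) (ν : ℂ) :
    TV (circleMul w z, t, ν) = (rotateSphereTwo w (TV (z, t, ν)).1, (TV (z, t, ν)).2) := by
  simp only [TV, rotateSphereTwo_cylPt]

/-- **The mirror symmetry of the graph zone**: `t ↦ -t` mirrors the tube point. [folklore] -/
theorem TV_neg {z : sphere (0 : EuclideanSpace ℝ (Fin 2)) 1} {t : ℝ} {ν : ℂ} (ht : zoneV t)
    (hν : ‖ν‖ ≤ nuMax) :
    TV (z, -t, ν) = (IwaseHandle.mirrorS2 (TV (z, t, ν)).1, (TV (z, t, ν)).2) := by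
  have hxi : xiV (-t) ν = -xiV t ν := by simp [xiV, XiF, SF]
  have hX : XV (-t) ν = XV t ν := by rw [XV, XV, hxi, neg_sq]
  have hW : WV (-t) ν = WV t ν := by rw [WV, WV, hX]
  simp only [TV, hxi, hW, mirrorS2_cylPt z (xiV_mem_Icc ht hν)]

/-! ### Exactness on the graph zone -/

/-- Products of circle points of unit complex numbers. [folklore] -/
theorem circleMul_circleOf {a b : ℂ} (ha : ‖a‖ = 1) (hb : ‖b‖ = 1) :
    circleMul (IwasePolar.circleOf a) (IwasePolar.circleOf b) = IwasePolar.circleOf (a * b) := by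
  have hab : ‖a * b‖ = 1 := by rw [norm_mul, ha, hb, mul_one]
  apply Subtype.ext
  rw [IwasePolar.coe_circleOf hab]
  ext i
  fin_cases i
  · simp [IwasePolar.coe_circleOf ha, IwasePolar.coe_circleOf hb]
  · simp [IwasePolar.coe_circleOf ha, IwasePolar.coe_circleOf hb]; ring

/-- **The correcting rotation of the graph zone**: the circle point of `(nrm E(ν))⁻¹`. [folklore] -/
def rotV (ν : ℂ) : sphere (0 : EuclideanSpace ℝ (Fin 2)) 1 :=
  IwasePolar.circleOf (UnknotSurgery.nrm (Efun ν))⁻¹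

/-- `rotV 0 = 1`. [folklore] -/
@[simp] theorem rotV_zero : rotV 0 = circlePoint 0 := by
  rw [rotV, Efun_zero, UnknotSurgery.nrm_of_norm_eq_one (by simp), inv_one]
  apply Subtype.ext
  rw [IwasePolar.coe_circleOf (by simp)]
  ext i; fin_cases i <;> simp [circlePoint]

/-- `rotV` is smooth on `‖ν‖ < 1`. [folklore] -/
theorem contMDiffAt_rotV {ν : ℂ} (hν : ‖ν‖ < 1) : ContMDiffAt 𝓘(ℝ, ℂ) (𝓡 1) ∞ rotV ν := by
  have hE := Efun_ne_zero hν
  have hn : UnknotSurgery.nrm (Efun ν) ≠ 0 := UnknotSurgery.nrm_ne_zero hE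
  have h1 : ContDiffAt ℝ ∞ (fun ν => (UnknotSurgery.nrm (Efun ν))⁻¹) ν :=
    ((UnknotSurgery.contDiffAt_nrm hE).comp ν contDiff_Efun.contDiffAt).inv hn
  exact (IwasePolar.contMDiffAt_circleOf (inv_ne_zero hn)).comp ν h1.contMDiffAt

/-- **The untwisted graph-zone map** `TV₁ (z, t, ν) = TV (rotV(ν) · z, t, ν)`, the formula of the
second torus over the graph zone. [folklore] -/
def TV1 (p : sphere (0 : EuclideanSpace ℝ (Fin 2)) 1 × ℝ × ℂ) :
    sphere (0 : EuclideanSpace ℝ (Fin 3)) 1 × EuclideanSpace ℝ (Fin 2) :=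
  TV (circleMul (rotV p.2.2) p.1, p.2.1, p.2.2)

/-- On the core `TV₁ = TV`. [folklore] -/
theorem TV1_zero (z : sphere (0 : EuclideanSpace ℝ (Fin 2)) 1) (t : ℝ) : TV1 (z, t, 0) = TV (z, t, 0) := by
  simp [TV1]

/-- **Exactness of the polar model on the graph-zone tube**: the polar map sends the sheared
tube point `TV (unit(v) · z, t, ν(v))` to `TV₁ (z, t, ν(v))` (the shear rotation `unit(v) = nrm ν`
is undone by the polar phase `(nrm ν)⁻¹ (nrm E)⁻¹`, leaving the smooth correction `rotV`).
[folklore] -/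
theorem polarMap_TV_shear {z : sphere (0 : EuclideanSpace ℝ (Fin 2)) 1} {t : ℝ} (ht : zoneV t)
    {v : EuclideanSpace ℝ (Fin 2)} (hv : v ≠ 0) :
    IwasePolar.polarMap (TV (circleMul (unitVector₀ v) z, t, nuOfV v)) = TV1 (z, t, nuOfV v) := by
  set ν := nuOfV v with hν_def
  have hν : ‖ν‖ ≤ nuMax := (norm_nuOfV_lt v).le
  have hν1 : ‖ν‖ < 1 := by linarith [nuMax_le]
  have hν0 : ν ≠ 0 := fun h => hv (nuOfV_eq_zero_iff.1 h)
  have hE := Efun_ne_zero hν1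
  have hunitν : ‖UnknotSurgery.nrm ν‖ = 1 := UnknotSurgery.norm_nrm hν0
  have hunitE : ‖(UnknotSurgery.nrm (Efun ν))⁻¹‖ = 1 := by
    rw [norm_inv, UnknotSurgery.norm_nrm hE, inv_one]
  have hpol : ‖(UnknotSurgery.nrm ν)⁻¹ * (UnknotSurgery.nrm (Efun ν))⁻¹‖ = 1 := by
    rw [norm_mul, norm_inv, hunitν, inv_one, one_mul, hunitE]
  -- the shear rotation is the circle point of `nrm ν`
  have hshear : unitVector₀ v = IwasePolar.circleOf (UnknotSurgery.nrm ν) := by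
    rw [hν_def, nrm_nuOfV, IwasePolar.circleOf_nrm_toC hv]
  rw [IwasePolar.polarMap, TV1]
  simp only
  rw [IwasePolar.polS, toC_TV_snd, xsq_TV_fst ht hν, TV_circleMul, TV_circleMul,
    rotateSphereTwo_rotateSphereTwo, hshear, pol_XV_WV_eq ht hν, rotV,
    circleMul_circleOf hpol hunitν]
  congr 2
  rw [mul_comm ((UnknotSurgery.nrm ν)⁻¹ * (UnknotSurgery.nrm (Efun ν))⁻¹) _, ← mul_assoc,
    mul_inv_cancel₀ (UnknotSurgery.nrm_ne_zero hν0), one_mul]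

end IwaseTori
end Literature.Topology.FourManifolds
end
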